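import Summits.Ventures.CertifiedQuantumChemistry.Rows.HubbardHalfFilledStrongCoupling
import Literature.MathematicalPhysics.QuantumLattice.HubbardSuperexchangeHeisenberg
import HarnessLib

/-!
# Ventures/CertifiedQuantumChemistry — Rows/HubbardHalfFilledHeisenbergLimit.lean: the strong-coupling
# constant of a half-filled Hubbard sector is `4t²` times the Heisenberg sector energy (any finite graph)

HONEST FRAMING (verbatim): certified bounds for a stated model Hamiltonian in a stated basis; not a
claim about the real molecule beyond that model.

Seat ref/typer (`pub-qchem-typer`, gen 20; the lead's word HOME/INBOX L845 TYP-52). THEOREMS ONLY (no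
`def`, no claim node, no row), zero compute, standard axioms; NOT a row, scores nothing, moves no
`CERTIFIED.md` byte. Sequel of `Rows/HubbardHalfFilledStrongCoupling.lean` (T-K0-4 part 1), which proved
`U · E_{(a,b)}(hamiltonian G t U) → E_{K₀}(−(hamiltonian G t 0)²)` at half filling and named the
identification of `−P A² P` with a Heisenberg model as NOT made. That identification is now the cited
Literature module `Literature/MathematicalPhysics/QuantumLattice/HubbardSuperexchangeHeisenberg.lean`
(Essler–Frahm–Göhmann–Klümper–Korepin 2005 App. 2.A (2.A.26)–(2.A.37); Takahashi 1999 §6.4 (6.98)):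
on pure spin states `⟨ψ| A² |ψ⟩ = t² Σ_{x∼y (ordered)} 2 (¼‖ψ‖² − ⟨ψ|𝐒_x·𝐒_y|ψ⟩)` with the tree's
fermionic `fermionSpinDot x y = 𝐒_x·𝐒_y`. This file draws the consequence for the cell's objects:

* §1 two generic facts about the sector energy `Matrix.minEnergyOn`: it depends only on the quadratic
  form on the subspace (`minEnergyOn_congr_of_forall_mem`) and scales with a nonnegative real factor
  (`minEnergyOn_real_smul`);
* §2 **`tendsto_mul_minEnergyOn_hamiltonian_halfFilled_heisenberg`**: for every finite graph `G`,
  hopping `t` and half-filled sector `(a, b)`, `a + b = |Λ|`,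
  `U · E_{(a,b)}(hamiltonian G t U) → 2t² · E_{K₀}(Σ_{x∼y (ordered)} (𝐒_x·𝐒_y − ¼))`
  `= 4t² · E_{K₀}(Σ_{edges} (𝐒_x·𝐒_y − ¼))` as `U → ∞`, where `K₀` is the coordinate subspace of the
  singly occupied `(a, b)` configurations (pure spin states of the sector, entering through its membership
  characterisation as in part 1) — Anderson's antiferromagnetic superexchange `J = 4t²/U` at the level of
  sector ground-state energies; `minEnergyOn_neg_sq_eq_heisenberg` is the time-independent identity
  `E_{K₀}(−A²) = 2t² E_{K₀}(Σ_{x∼y}(𝐒_x·𝐒_y − ¼))` behind it;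
* §3 the cell's model object: for the TV-H ring file `hubbardRingTV L 1 U` with `L = n + n`,
  **`tendsto_mul_energy_hubbardRingTV_halfFilled`**:
  `U · Model.energy (hubbardRingTV L 1 U) n n → 2 · E_{K₀}(Σ_{x∼y on the L-ring (ordered)} (𝐒_x·𝐒_y − ¼))`
  along `U → ∞` in `ℚ` — i.e. `−4 h(L)` of `HOME/STRUCTURE.md` §2.2.3 with `h(L) := L/4 − E_Heis(L)`,
  `E_Heis(L)` the `S_z = 0` (= `(n,n)`-sector) ground-state energy of the spin-½ Heisenberg ring
  `Σ_{bonds} 𝐒_x·𝐒_{x+1}` realised on the pure spin states of the Fock space, for EVERY even `L` at once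
  (the constants `−12` (`L = 4`, `Rows/HubbardRingStrongCouplingLimit`) and `−2(5+√13)` (`L = 6`,
  `Rows/HubbardRingL6StrongCouplingLimit`) are its first two values).

Not here: the unitary identification of the pure spin states / fermionic `𝐒_x·𝐒_y` with the tree's
spin-chain `heisenbergRing` on `Op Λ 2` (the Literature module states why it is not needed for energies);
any value of `E_Heis(L)` for `L ≥ 8` (`L = 8`: `4h(8)` is the largest root of `x³ − 40x² + 464x − 1600`,
not formalised); any relaxation value; any rate in `1/U`.

References: Essler et al. (2005) App. 2.A [EsslerEtAl2005]; Takahashi (1999) §6.4 [Takahashi1999];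
T. Kato (1966) Ch. II §2.3 [Kato1966]; P. W. Anderson, Phys. Rev. 115 (1959) 2. Tree (REUSED): part 1
(`tendsto_mul_minEnergyOn_hamiltonian_halfFilled`, `singly_of_halfFilled`, `mem_pi_compl_bot_iff`),
`star_dotProduct_hamiltonian_zero_sq_mulVec` (the Literature module), `hubbardRingTV_hamiltonian_eq_one`,
`sectorGroundEnergy_def`, `upPart_pairSet` / `downPart_pairSet`; Mathlib `Real.sInf_smul_of_nonneg`,
`Finset.exists_subset_card_eq`, `tendsto_ratCast_atTop_iff`. Typer `pub-qchem-typer` (gen 20), 0 core-h.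
-/

noncomputable section

namespace Summit.Ventures.CertifiedQuantumChemistry

open Matrix Finset Filter Topology
open Literature.MathematicalPhysics.QuantumLattice Literature.MathematicalPhysics.QuantumChemistry
open Literature.MathematicalPhysics.QuantumLattice.TwoSpecies LiebThm1
open Summit.Ventures.CertifiedQuantumChemistry.Hamiltonians

/-! ## §1 Two generic facts about `Matrix.minEnergyOn` -/

section Generic

open scoped Pointwise

variable {n : Type*} [Fintype n]

/-- The sector energy `E_K(A) = inf {Re ⟨ψ, Aψ⟩ : ψ ∈ K, ‖ψ‖ = 1}` depends only on the quadratic form of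
`A` on `K`. -/
theorem minEnergyOn_congr_of_forall_mem {A B : Matrix n n ℂ} {K : Submodule ℂ (n → ℂ)}
    (h : ∀ ψ ∈ K, star ψ ⬝ᵥ A *ᵥ ψ = star ψ ⬝ᵥ B *ᵥ ψ) : A.minEnergyOn K = B.minEnergyOn K := by
  simp only [Matrix.minEnergyOn]
  congr 1
  ext E
  constructor
  · rintro ⟨ψ, hψ, h1, rfl⟩
    exact ⟨ψ, hψ, h1, by rw [h ψ hψ]⟩
  · rintro ⟨ψ, hψ, h1, rfl⟩
    exact ⟨ψ, hψ, h1, by rw [h ψ hψ]⟩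

/-- The sector energy scales with a nonnegative real factor: `E_K(c • A) = c · E_K(A)` for `0 ≤ c`. -/
theorem minEnergyOn_real_smul (A : Matrix n n ℂ) (K : Submodule ℂ (n → ℂ)) {c : ℝ} (hc : 0 ≤ c) :
    ((c : ℂ) • A).minEnergyOn K = c * A.minEnergyOn K := by
  simp only [Matrix.minEnergyOn]
  have hset : {E : ℝ | ∃ ψ ∈ K, star ψ ⬝ᵥ ψ = 1 ∧ E = (star ψ ⬝ᵥ ((c : ℂ) • A) *ᵥ ψ).re} =
      c • {E : ℝ | ∃ ψ ∈ K, star ψ ⬝ᵥ ψ = 1 ∧ E = (star ψ ⬝ᵥ A *ᵥ ψ).re} := by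
    ext E
    simp only [Set.mem_smul_set, Set.mem_setOf_eq, smul_eq_mul]
    constructor
    · rintro ⟨ψ, hψ, h1, rfl⟩
      exact ⟨_, ⟨ψ, hψ, h1, rfl⟩, by rw [Matrix.smul_mulVec, dotProduct_smul, smul_eq_mul, Complex.re_ofReal_mul]⟩
    · rintro ⟨E', ⟨ψ, hψ, h1, rfl⟩, rfl⟩
      exact ⟨ψ, hψ, h1, by rw [Matrix.smul_mulVec, dotProduct_smul, smul_eq_mul, Complex.re_ofReal_mul]⟩
  rw [hset, Real.sInf_smul_of_nonneg hc, smul_eq_mul]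

end Generic

/-! ## §2 Half-filled sectors of a graph Hubbard model: `E_{K₀}(−A²) = 2t² E_{K₀}(Σ_{x∼y} (𝐒_x·𝐒_y − ¼))` -/

section HalfFilling

variable {Λ : Type*} [LinearOrder Λ] [Fintype Λ] (G : SimpleGraph Λ) [DecidableRel G.Adj]

/-- A vector of `K₀` (supported on the singly occupied `(a,b)` configurations, `a + b = |Λ|`) is supported
on singly occupied configurations in the sense of the Literature module (`x↑ ∈ s ↔ x↓ ∉ s`). -/
theorem singly_of_mem_K0 {a b : ℕ} (hab : a + b = Fintype.card Λ) {K₀ : Submodule ℂ (Fock (Orb Λ))}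
    (hK₀ : ∀ ψ, ψ ∈ K₀ ↔ ∀ s : Finset (Orb Λ),
      ¬(((upPart s).card = a ∧ (downPart s).card = b) ∧ (doublyOccupied s).card = 0) → ψ s = 0)
    {ψ : Fock (Orb Λ)} (hψ : ψ ∈ K₀) (s : Finset (Orb Λ)) (hs : ψ s ≠ 0) (z : Λ) :
    orb z 0 ∈ s ↔ orb z 1 ∉ s := by
  have hmem : ((upPart s).card = a ∧ (downPart s).card = b) ∧ (doublyOccupied s).card = 0 := by
    by_contra h
    exact hs ((hK₀ ψ).1 hψ s h)
  exact singly_of_halfFilled (by rw [hmem.1.1, hmem.1.2, hab]) hmem.2 z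

/-- **The quadratic forms agree on `K₀`**: for `ψ ∈ K₀`,
`⟨ψ| −A² |ψ⟩ = 2t² ⟨ψ| Σ_{x∼y (ordered)} (𝐒_x·𝐒_y − ¼) |ψ⟩`, `A = hamiltonian G t 0` (the Literature
module's `star_dotProduct_hamiltonian_zero_sq_mulVec`, rearranged). -/
theorem star_dotProduct_neg_sq_mulVec_eq_heisenberg (t : ℝ) {a b : ℕ} (hab : a + b = Fintype.card Λ)
    {K₀ : Submodule ℂ (Fock (Orb Λ))}
    (hK₀ : ∀ ψ, ψ ∈ K₀ ↔ ∀ s : Finset (Orb Λ),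
      ¬(((upPart s).card = a ∧ (downPart s).card = b) ∧ (doublyOccupied s).card = 0) → ψ s = 0)
    {ψ : Fock (Orb Λ)} (hψ : ψ ∈ K₀) :
    star ψ ⬝ᵥ (-(hamiltonian G t 0 * hamiltonian G t 0)) *ᵥ ψ =
      star ψ ⬝ᵥ (((2 * t ^ 2 : ℝ) : ℂ) • ∑ x : Λ, ∑ y : Λ, (if G.Adj x y then (1 : ℂ) else 0) •
        (fermionSpinDot x y - (1 / 4 : ℂ) • (1 : Matrix (Finset (Orb Λ)) (Finset (Orb Λ)) ℂ))) *ᵥ ψ := by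
  rw [Matrix.neg_mulVec, dotProduct_neg,
    star_dotProduct_hamiltonian_zero_sq_mulVec G t (fun s hs => singly_of_mem_K0 hab hK₀ hψ s hs)]
  simp only [Matrix.smul_mulVec, dotProduct_smul, Matrix.sum_mulVec, dotProduct_sum, Matrix.sub_mulVec,
    dotProduct_sub, Matrix.one_mulVec, smul_eq_mul, Finset.mul_sum, ← Finset.sum_neg_distrib]
  refine Finset.sum_congr rfl fun x _ => Finset.sum_congr rfl fun y _ => ?_
  split_ifs
  · push_cast; ring
  · simp

/-- **`E_{K₀}(−A²) = 2t² · E_{K₀}(Σ_{x∼y (ordered)} (𝐒_x·𝐒_y − ¼))`** on the pure spin states of a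
half-filled sector (`= 4t² · E_{K₀}(Σ_{edges} (𝐒_x·𝐒_y − ¼))`, each edge being counted twice). -/
theorem minEnergyOn_neg_sq_eq_heisenberg (t : ℝ) {a b : ℕ} (hab : a + b = Fintype.card Λ)
    {K₀ : Submodule ℂ (Fock (Orb Λ))}
    (hK₀ : ∀ ψ, ψ ∈ K₀ ↔ ∀ s : Finset (Orb Λ),
      ¬(((upPart s).card = a ∧ (downPart s).card = b) ∧ (doublyOccupied s).card = 0) → ψ s = 0) :
    (-(hamiltonian G t 0 * hamiltonian G t 0)).minEnergyOn K₀ =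
      2 * t ^ 2 * (∑ x : Λ, ∑ y : Λ, (if G.Adj x y then (1 : ℂ) else 0) •
        (fermionSpinDot x y - (1 / 4 : ℂ) • (1 : Matrix (Finset (Orb Λ)) (Finset (Orb Λ)) ℂ))).minEnergyOn K₀ := by
  rw [minEnergyOn_congr_of_forall_mem
      (fun ψ hψ => star_dotProduct_neg_sq_mulVec_eq_heisenberg G t hab hK₀ hψ),
    minEnergyOn_real_smul _ _ (by positivity)]

/-- **The strong-coupling limit of a half-filled Hubbard sector is the Heisenberg antiferromagnet
(`J = 4t²/U`) at the level of sector energies**: for every finite graph `G`, hopping `t` and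
`a + b = |Λ|`,
`U · E_{(a,b)}(hamiltonian G t U) → 2t² · E_{K₀}(Σ_{x∼y (ordered)} (𝐒_x·𝐒_y − ¼)) = 4t² · E_{K₀}(Σ_{edges}(𝐒_x·𝐒_y − ¼))`
as `U → ∞`, `K₀` = the pure spin states of the sector (T-K0-4 part 1 + the Literature identification). -/
theorem tendsto_mul_minEnergyOn_hamiltonian_halfFilled_heisenberg (t : ℝ) {a b : ℕ}
    (hab : a + b = Fintype.card Λ) {K₀ : Submodule ℂ (Fock (Orb Λ))}
    (hK₀ : ∀ ψ, ψ ∈ K₀ ↔ ∀ s : Finset (Orb Λ),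
      ¬(((upPart s).card = a ∧ (downPart s).card = b) ∧ (doublyOccupied s).card = 0) → ψ s = 0)
    (hne : ∃ s : Finset (Orb Λ),
      ((upPart s).card = a ∧ (downPart s).card = b) ∧ (doublyOccupied s).card = 0) :
    Tendsto (fun U : ℝ => U * (hamiltonian G t U).minEnergyOn (szSector (a + b) (((a : ℝ) - b) / 2)))
      atTop (𝓝 (2 * t ^ 2 * (∑ x : Λ, ∑ y : Λ, (if G.Adj x y then (1 : ℂ) else 0) •
        (fermionSpinDot x y - (1 / 4 : ℂ) • (1 : Matrix (Finset (Orb Λ)) (Finset (Orb Λ)) ℂ))).minEnergyOn K₀)) := by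
  have h := tendsto_mul_minEnergyOn_hamiltonian_halfFilled G t hab hK₀ hne
  rwa [minEnergyOn_neg_sq_eq_heisenberg G t hab hK₀] at h

end HalfFilling

/-! ## §3 The cell's model object: the half-filled TV-H ring `hubbardRingTV L 1 U`, `L = n + n` -/

section Ring

/-- At half filling on `L = n + n` sites the sector `(n, n)` contains a singly occupied configuration
(`n` up-electrons on some `n`-subset, the down-electrons on its complement). -/
theorem exists_singly_halfFilled_config {L n : ℕ} (hL : n + n = L) :
    ∃ s : Finset (Orb (Fin L)),
      ((upPart s).card = n ∧ (downPart s).card = n) ∧ (doublyOccupied s).card = 0 := by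
  obtain ⟨α, -, hα⟩ := Finset.exists_subset_card_eq (s := (Finset.univ : Finset (Fin L))) (n := n)
    (by rw [Finset.card_univ, Fintype.card_fin]; omega)
  refine ⟨pairSet α αᶜ, ?_, ?_⟩
  · rw [upPart_pairSet, downPart_pairSet, Finset.card_compl, hα, Fintype.card_fin]
    exact ⟨rfl, by omega⟩
  · rw [doublyOccupied, upPart_pairSet, downPart_pairSet, Finset.card_eq_zero, ← Finset.disjoint_iff_inter_eq_empty]
    exact disjoint_compl_right

/-- **The strong-coupling constant of the half-filled Hubbard ring, every even length at once.** For the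
TV-H integral file of the `L`-site ring (`hubbardRingTV L 1 U`, `t = 1`, `U ∈ ℚ`), `L = n + n`, the cell's
QUANTITY `Model.energy _ n n = E₀(H_F; N_α = N_β = n)` satisfies
`U · E₀ → 2 · E_{K₀}(Σ_{x∼y on the ring (ordered)} (𝐒_x·𝐒_y − ¼)) = 4 · E_{K₀}(Σ_{bonds} (𝐒_x·𝐒_{x+1} − ¼))`
as `U → ∞` along `ℚ` — in the notation of `HOME/STRUCTURE.md` §2.2.3, `−4 h(L)` with `h(L) = L/4 − E_Heis(L)`,
the Heisenberg ring energy being taken in the `(n,n)` (`S_z = 0`) pure-spin sector `K₀` of the Fock space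
(`K₀` through its membership characterisation; e.g. Mathlib's `Submodule.pi (↑Z)ᶜ ⊥`). The values `−12`
(`L = 4`) and `−2(5+√13)` (`L = 6`) of the two earlier files are instances. -/
theorem tendsto_mul_energy_hubbardRingTV_halfFilled {L n : ℕ} (hL : n + n = L)
    {K₀ : Submodule ℂ (Fock (Orb (Fin L)))}
    (hK₀ : ∀ ψ, ψ ∈ K₀ ↔ ∀ s : Finset (Orb (Fin L)),
      ¬(((upPart s).card = n ∧ (downPart s).card = n) ∧ (doublyOccupied s).card = 0) → ψ s = 0) :
    Tendsto (fun U : ℚ => (U : ℝ) * (hubbardRingTV L 1 U).energy n n) atTop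
      (𝓝 (2 * (∑ x : Fin L, ∑ y : Fin L, (if (ringGraph L).Adj x y then (1 : ℂ) else 0) •
        (fermionSpinDot x y - (1 / 4 : ℂ) • (1 : Matrix (Finset (Orb (Fin L))) (Finset (Orb (Fin L))) ℂ))).minEnergyOn
          K₀)) := by
  have hab : n + n = Fintype.card (Fin L) := by rw [Fintype.card_fin, hL]
  have hgen := tendsto_mul_minEnergyOn_hamiltonian_halfFilled_heisenberg (ringGraph L) 1 hab hK₀
    (exists_singly_halfFilled_config hL)
  rw [one_pow, mul_one] at hgen
  have h := hgen.comp (tendsto_ratCast_atTop_iff.2 tendsto_id)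
  refine h.congr fun U => ?_
  simp only [Function.comp_apply, id_eq, Model.energy, sectorGroundEnergy_def, hubbardRingTV_hamiltonian_eq_one]

/-- The same limit on the matrix and the joint sector `szSector L 0` (`= szSector (n + n) ((n − n)/2)`), the
spelling of `HOME/STRUCTURE.md` §2. -/
theorem tendsto_mul_minEnergyOn_szSector_hubbardRingTV_halfFilled {L n : ℕ} (hL : n + n = L)
    {K₀ : Submodule ℂ (Fock (Orb (Fin L)))}
    (hK₀ : ∀ ψ, ψ ∈ K₀ ↔ ∀ s : Finset (Orb (Fin L)),
      ¬(((upPart s).card = n ∧ (downPart s).card = n) ∧ (doublyOccupied s).card = 0) → ψ s = 0) :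
    Tendsto (fun U : ℚ => (U : ℝ) * (hubbardRingTV L 1 U).hamiltonian.minEnergyOn (szSector L 0)) atTop
      (𝓝 (2 * (∑ x : Fin L, ∑ y : Fin L, (if (ringGraph L).Adj x y then (1 : ℂ) else 0) •
        (fermionSpinDot x y - (1 / 4 : ℂ) • (1 : Matrix (Finset (Orb (Fin L))) (Finset (Orb (Fin L))) ℂ))).minEnergyOn
          K₀)) := by
  refine (tendsto_mul_energy_hubbardRingTV_halfFilled hL hK₀).congr fun U => ?_
  rw [Model.energy, sectorGroundEnergy_def, sub_self, zero_div, hL]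

end Ring

end Summit.Ventures.CertifiedQuantumChemistry

end
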